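import Literature.NumberTheory.EllipticCurves.BSDConductorSemistableProofs
import Literature.NumberTheory.EllipticCurves.WeilPairingProofs
import HarnessLib

/-!
# bsd.S15 (d), ideal form for elliptic curves: `𝔣(E/ℚ) = 𝔣^{(ℓ)}(V_ℓ E) · (ℓ)^{f_ℓ}` from three leaves

Sibling proof file (theorems only) of `Literature.NumberTheory.EllipticCurves.BSDConductor` for
its *corrected* named fact `Literature.BSD.conductor_eq_conductorOf_mul_of_isElliptic W ℓ` — for an
elliptic curve `E/ℚ` (`W : WeierstrassCurve ℚ`, `[W.IsElliptic]` quantified in the body) and every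
prime `ℓ`, the conductor ideal `𝔣(E/ℚ) = ∏_v v^{f_v}` of `𝓞 ℚ` (item G22, `f_v` *defined* by
Ogg's formula `ord_v Δ_min + 1 - m_v`) is the prime-to-`ℓ` Artin conductor
`𝔣^{(ℓ)}(V_ℓ E) = ∏_{v ∤ ℓ} v^{a_v(V_ℓ E)}` (item C15 `Literature.NumberTheory.EllipticCurves.conductorOf`) times `v_ℓ^{f_ℓ}`
(Silverman, *ATAEC*, §IV.10: Definition of `ε, δ, f = ε + δ` and Thm. 10.2, PDF p. 358;
Definition of `𝔣(E/K)`, PDF p. 364; §IV.11, Ogg's formula 11.1, PDF p. 365; Serre–Tate 1968,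
§2.1 and §3).

The printed content is Ogg–Saito's formula in Galois form, `a_v(V_ℓ E) = f_v(E)` for every
`v ∤ ℓ` (the corrected C15 fact
`WeierstrassCurve.artinConductorExponent_tate_eq_conductorExponent_of_isElliptic`), which the
tree decomposes place by place (`HasseWeilAbelianConductor`, `…Proofs`): good places — theorems
(*AEC* VII.4.1(b)); tame part at the bad places — Silverman *ATAEC* Thm. IV.10.2(a),
multiplicative and additive cases (named facts `hTm`, `hTa` below; reduced further to Serre–Tate's
fundamental isomorphism `hST` in `HasseWeilAbelianInertiaInvariantsProofs`); wild part — Thm.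
IV.10.2(b) at the multiplicative places, a **theorem** given `hTm` and the Weil pairings
(`TateModuleUnipotentInertiaProofs`: unipotent inertia is tame), and Ogg's formula IV.11.1 at the
additive places (named fact `hWa`, the Ogg–Saito theorem proper, not proved in the book for
residue characteristic `2`, PDF p. 366).  The Weil pairings are now a **theorem** of the tree
(`WeierstrassCurve.exists_weilPairing_holds`, `WeilPairingProofs`, Silverman *AEC* III.8.1), so
this file records the assemblies with that hypothesis discharged:

* `WeierstrassCurve.artinConductorExponent_tate_eq_conductorExponent_of_isElliptic_of_codim_of_ogg`
  (any number field `K`): the corrected C15 fact from the three leaves `hTm`, `hTa`, `hWa`;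
  `…_of_isSemistable_of_codim` (semistable `E/K`: from `hTm` alone);
  `…_of_serreTate_of_ogg`, `…_of_isSemistable_of_serreTate` (with 10.2(a) supplied by Serre–Tate's
  isomorphism `hST`);
* `Literature.NumberTheory.EllipticCurves.conductor_eq_conductorOf_mul_of_isElliptic_of_codim_of_ogg` (over `ℚ`): **the target
  fact from the three leaves**; `…_of_isSemistable_of_codim` (semistable `E/ℚ`: from `hTm` alone);
  `…_of_serreTate_of_ogg`, `…_of_isSemistable_of_serreTate`; and the numerical companions
  `Literature.NumberTheory.EllipticCurves.conductorNorm_eq_artinConductorNat_of_isElliptic_of_codim_of_ogg`,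
  `…_of_isSemistable_of_codim`.

So the discharge `conductor_eq_conductorOf_mul_of_isElliptic_holds` is
`conductor_eq_conductorOf_mul_of_isElliptic_of_codim_of_ogg` fed with the three leaf discharges
(`hTm`, `hTa`: Silverman *ATAEC* IV.10.2(a) via Kodaira–Néron and the reduction sequence,
p. 359; `hWa`: Ogg 1967 / Saito 1988), none of which is in reach of Mathlib at present; for a
semistable curve only `hTm` remains.

## References

* J. H. Silverman, *Advanced Topics in the Arithmetic of Elliptic Curves*, GTM 151 (1994), §IV.10
  (Definition of `ε, δ, f` and Thm. 10.2, PDF p. 358; proof of 10.2(a),(b), pp. 359–362;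
  Definition of `𝔣(E/K)` and Example 10.5, p. 364), §IV.11 (Ogg's formula 11.1, pp. 365–366).
  [SilvermanATAEC1994]
* J. H. Silverman, *The Arithmetic of Elliptic Curves*, 2nd ed. (2009), Prop. III.8.1 (Weil
  pairing), VII.4.1. [SilvermanAEC2009]
* J.-P. Serre, J. Tate, *Good reduction of abelian varieties*, Ann. of Math. 88 (1968), §1, §2.1,
  §3. [SerreTate1968]

## Repair (2026-08-14): de-duplication against `BSDConductorSemistableProofs`

Five of the assemblies originally recorded here
(`WeierstrassCurve.artinConductorExponent_tate_eq_conductorExponent_of_isElliptic_of_codim_of_ogg`,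
`WeierstrassCurve.swanConductorAt_rationalTate_eq_zero_of_hasMultiplicativeReductionAt_of_codim`,
`WeierstrassCurve.artinConductorExponent_tate_eq_conductorExponent_of_isElliptic_of_serreTate_of_ogg`,
`Literature.NumberTheory.EllipticCurves.conductorNorm_eq_artinConductorNat_of_isElliptic_of_codim_of_ogg`,
`Literature.NumberTheory.EllipticCurves.conductorNorm_eq_artinConductorNat_of_isElliptic_of_isSemistable_of_codim`) landed at the
same time, under the same names and with the same statements, in the imported sibling
`BSDConductorSemistableProofs` (section `WeilPairingDischarged`); the local copies were removed so
that the two files elaborate together, and the remaining theorems below use the upstream ones;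
likewise the two number-field semistable assemblies formerly here
(`…_of_isElliptic_of_isSemistable_of_codim`, `…_of_isElliptic_of_isSemistable_of_serreTate`) are
the upstream `WeierstrassCurve.artinConductorExponent_tate_eq_conductorExponent_of_isSemistable_of_codim`
and `…_of_isSemistable_of_serreTate'` (same statements) and were removed as duplicates.  What is
specific to this file is the ideal form over `ℚ` (namespace `Literature.BSD`, `conductor_eq_conductorOf_mul_…`).

## Design

Theorems only, no definitions; `noncomputable section`; the hypotheses are the tree's named facts
verbatim; `[W.IsElliptic]` is introduced from the body of the corrected facts (a `Prop`-valued
`def` does not pick up section instances, see `BSDConductor`, "Status of the declarations").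
-/

noncomputable section

open scoped Classical NumberField
open IsDedekindDomain Field

universe u

/-! ### Over a number field: the corrected C15 fact from three leaves

(The assemblies over a number field — `…_of_codim_of_ogg`, `…_of_serreTate_of_ogg`,
`…_of_isSemistable_of_codim`, `…_of_isSemistable_of_serreTate'`, and 10.2(b) at the multiplicative
places `swanConductorAt_rationalTate_eq_zero_of_hasMultiplicativeReductionAt_of_codim` — live in
the imported `BSDConductorSemistableProofs`, section `WeilPairingDischarged`; see "Repair" above.) -/

/-! ### Over `ℚ`: the corrected bsd.S15 (d) facts from the reduced set of leaves -/

namespace Literature.NumberTheory.EllipticCurves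

open WeierstrassCurve

variable (W : WeierstrassCurve ℚ) (ℓ : ℕ) [Fact ℓ.Prime]

/-- **bsd.S15 (d), ideal form for elliptic curves, from three leaves.**  The corrected named fact
`Literature.BSD.conductor_eq_conductorOf_mul_of_isElliptic W ℓ` (`𝔣(E/ℚ) = 𝔣^{(ℓ)}(V_ℓ E) · v_ℓ^{f_ℓ}`
for an elliptic `W / ℚ` and a prime `ℓ`; Silverman *ATAEC* §IV.10 Definition of the conductor,
PDF p. 364, with Thm. 10.2 and Ogg's formula 11.1) follows from Silverman *ATAEC* Thm. IV.10.2(a)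
at the multiplicative and additive places (`hTm`, `hTa`) and Ogg's formula IV.11.1 for the wild
part at the additive places (`hWa`): the exponentwise identity is
`artinConductorExponent_tate_eq_conductorExponent_of_isElliptic_of_codim_of_ogg`, the passage to
ideals `conductor_eq_conductorOf_mul_of_isElliptic_of_tate` (`BSDConductorIdealFormProofs`, a
`finprod` over the finitely many bad places).  The discharge
`conductor_eq_conductorOf_mul_of_isElliptic_holds` is this theorem fed with the three leaf
discharges. [cite: SilvermanATAEC1994, §IV.10 Definition of the conductor (PDF p. 364) with Thm. IV.10.2 and Thm. IV.11.1 (pp. 358–366)] -/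
theorem conductor_eq_conductorOf_mul_of_isElliptic_of_codim_of_ogg
    (hTm : W.codimFixed_inertia_rationalTate_eq_one_of_hasMultiplicativeReductionAt ℓ)
    (hTa : W.codimFixed_inertia_rationalTate_eq_two_of_hasAdditiveReductionAt ℓ)
    (hWa : W.swanConductorAt_rationalTate_eq_wildConductorExponent_of_hasAdditiveReductionAt ℓ) :
    conductor_eq_conductorOf_mul_of_isElliptic W ℓ := by
  intro _ h
  exact conductor_eq_conductorOf_mul_of_isElliptic_of_tate W ℓ
    (W.artinConductorExponent_tate_eq_conductorExponent_of_isElliptic_of_codim_of_ogg ℓ hTm hTa hWa) h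

/-- **bsd.S15 (d), ideal form, for semistable elliptic curves over `ℚ` from a single leaf.**  For
a semistable elliptic `W / ℚ`, `conductor_eq_conductorOf_mul_of_isElliptic W ℓ` follows from
Silverman *ATAEC* Thm. IV.10.2(a) at the multiplicative places (`hTm`) alone (Example 10.5).
[cite: SilvermanATAEC1994, Thm. IV.10.2 and Example 10.5 (PDF pp. 358–364)] -/
theorem conductor_eq_conductorOf_mul_of_isElliptic_of_isSemistable_of_codim
    (hs : W.IsSemistable (𝓞 ℚ))
    (hTm : W.codimFixed_inertia_rationalTate_eq_one_of_hasMultiplicativeReductionAt ℓ) :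
    conductor_eq_conductorOf_mul_of_isElliptic W ℓ := by
  intro _ h
  exact conductor_eq_conductorOf_mul_of_isElliptic_of_tate W ℓ
    (W.artinConductorExponent_tate_eq_conductorExponent_of_isSemistable_of_codim ℓ hs hTm) h

/-- **bsd.S15 (d), ideal form for elliptic curves, from Serre–Tate's fundamental isomorphism and
Ogg's formula at the additive places.**
[cite: SilvermanATAEC1994, §IV.10 Definition (PDF p. 364) with Thm. IV.10.2, its proof, and Thm. IV.11.1 (pp. 358–366)] -/
theorem conductor_eq_conductorOf_mul_of_isElliptic_of_serreTate_of_ogg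
    (hST : W.nonempty_fixedSubmodule_inertia_rationalTate_equiv_reductionPoints ℓ)
    (hWa : W.swanConductorAt_rationalTate_eq_wildConductorExponent_of_hasAdditiveReductionAt ℓ) :
    conductor_eq_conductorOf_mul_of_isElliptic W ℓ :=
  conductor_eq_conductorOf_mul_of_isElliptic_of_codim_of_ogg W ℓ
    (W.codimFixed_inertia_rationalTate_eq_one_of_hasMultiplicativeReductionAt_of_serreTate ℓ hST)
    (W.codimFixed_inertia_rationalTate_eq_two_of_hasAdditiveReductionAt_of_serreTate ℓ hST) hWa

/-- **bsd.S15 (d), ideal form, for semistable elliptic curves over `ℚ` from Serre–Tate's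
fundamental isomorphism alone.**
[cite: SilvermanATAEC1994, Thm. IV.10.2(a),(b), their proof, and Example 10.5 (PDF pp. 358–364)] -/
theorem conductor_eq_conductorOf_mul_of_isElliptic_of_isSemistable_of_serreTate
    (hs : W.IsSemistable (𝓞 ℚ))
    (hST : W.nonempty_fixedSubmodule_inertia_rationalTate_equiv_reductionPoints ℓ) :
    conductor_eq_conductorOf_mul_of_isElliptic W ℓ :=
  conductor_eq_conductorOf_mul_of_isElliptic_of_isSemistable_of_codim W ℓ hs
    (W.codimFixed_inertia_rationalTate_eq_one_of_hasMultiplicativeReductionAt_of_serreTate ℓ hST)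

end Literature.NumberTheory.EllipticCurves

end
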